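import Literature.NumberTheory.Transcendental.LinGroupK
import Literature.NumberTheory.Transcendental.LinearSubgroupTheoremAssembly
import Mathlib.Algebra.MvPolynomial.Funext
import HarnessLib

/-!
# The Linear Subgroup Theorem on `𝔾ₐ^{d₀} × 𝔾ₘ^{d₁}` over a general field, assembled from a zero estimate and an auxiliary function (Waldschmidt 1988, §7)

Topic `Literature/NumberTheory/Transcendental` (namespace `Literature.NumberTheory.Transcendental`,
grouping sub-namespace `LinGroupK`). Everything here is PROVED; definitions with bodies; no named
facts. It is the field-generic form of the tree's complex assembly
`LinGroup.weakObstruction_of_zeroEstimate_of_auxiliary` (`LinearSubgroupTheoremAssembly.lean`), i.e.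
of the half page "§7. Philippon's zero estimate … This completes the proof of Theorem 4.1" of
[Waldschmidt1988, p. 390], written once for a field `K` of characteristic `0` and an ABSTRACT group
homomorphism `γ : ℤ^m → G(K) = K^{d₀} × (Kˣ)^{d₁}` in place of `h ↦ exp_G(h₁y₁ + ⋯ + h_my_m)`:

* the complex case is `γ(h) = exp_G(y_h)` (periods `Ω = 0 × 2πiℚ^{d₁}`);
* the `p`-adic case ([Roy1992, §1 Theorem 1]: "`K = ℂ` or `ℂ_p`", the statement being M.
  Waldschmidt's [Waldschmidt1988, Thm 4.1] over `ℂ_p`) is `K = ℚ̄_p`, `γ(h) = exp_G(y_h)` with the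
  `p`-adic exponential on a small ball (no periods), which is what this file is for.

The only place where the complex proof uses the exponential map beyond the homomorphism property
is the description of the lattice of an obstruction, `{h ; γ(h) ∈ G'} ⊆ φ⁻¹(Lie G' + Ω)`; here this
is an explicit HYPOTHESIS `hQ : γ(h) ∈ G' → h ∈ Q(G')` for a given assignment `Q` of
`ℚ`-subspaces of `ℚ^m` to connected algebraic subgroups, and the conclusion is stated with
`λ = m − dim_ℚ Q(G')`. The two other inputs are, as in the complex file, explicit hypotheses:

* `hZE : LinGroupK.ZeroEstimate K d₀ d₁` — Philippon's zero estimate with multiplicities on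
  `𝔾ₐ^{d₀} × 𝔾ₘ^{d₁}` over `K` ([Philippon1986, Thm 2.1]; [Waldschmidt1988, Prop. 7.1]) with the
  algebraic order of vanishing (`LinGroupK.lean`; over `ℚ̄_p` it follows from the complex one,
  `LinGroupK.zeroEstimate_padicAlgCl_of_complex`);
* `hAF` — the auxiliary function of [Waldschmidt1988, Prop. 6.1] with `a = 1`, `b = 2`,
  `d₂ = κ = 0`: for `S ≥ S₀` a nonzero `P_S` with `deg_X P_S ≤ Δ/(log S)²`, `deg_Y P_S ≤ Δ/S`,
  vanishing (algebraically) to order `≥ T ≥ Δ/log S` along `W` at the points `γ(h)`,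
  `0 ≤ hⱼ ≤ S`, where `Δ^{d−n} = C S^{d₁} (log S)^{2d₀}` (the tree's `LinGroup.auxDelta`).

Conclusion (`LinGroupK.weakObstruction_of_zeroEstimate_of_auxiliary`): an obstruction `G' = E × T'`
with `Lie G' + W ≠ Lie G` (`δ > τ`) and `(λ + δ₁)(d − n) ≤ (δ − τ) d₁`, `λ = m − dim_ℚ Q(G')`.
The real-variable bookkeeping ((7.2) ⟹ (7.3) ⟹ comparison of exponents) is IMPORTED from the
complex file (`LinGroup.exponent_ineq_of_key`, `exponents_of_bad`, `eventually_lt_of_exponents`,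
`key_real`, `auxDelta`, `exists_coord_complement_rat`, …: pure statements about `ℕ`, `ℝ`, `ℚ^ℓ`);
the group-theoretic bookkeeping is re-proved over `K` word for word.

## References

* [Waldschmidt1988] M. Waldschmidt, *On the transcendence methods of Gel'fond and Schneider in
  several variables*, New Advances in Transcendence Theory (A. Baker ed.), CUP 1988, 375–398:
  §4 Theorem 4.1 (pp. 382–383); §7 Proposition 7.1, (7.2)–(7.3) and the end of the proof (p. 390).
* [Philippon1986] P. Philippon, *Lemmes de zéros dans les groupes algébriques commutatifs*,
  Bull. Soc. Math. France 114 (1986), 355–383, Théorème 2.1.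
* [NesterenkoPhilippon2001] Yu. V. Nesterenko, P. Philippon (eds.), *Introduction to Algebraic
  Independence Theory*, LNM 1752, Springer 2001, Ch. 11 (D. Roy), proof of Cor. 4.2 (p. 222).
* [Roy1992] D. Roy, *Matrices whose coefficients are linear forms in logarithms*, J. Number
  Theory 41 (1992) 22–47, §1 Theorem 1 (p. 25).
-/

noncomputable section

namespace Literature.NumberTheory.Transcendental.LinGroupK

open Module Submodule MvPolynomial
open Literature.NumberTheory.Transcendental.LinGroup (finrank_prod_eq exists_coord_complement_rat
  pow_le_factorial_mul_choose eventually_lt_of_exponents exponent_ineq_of_key exponents_of_bad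
  key_real choose_diag_mono auxDelta eventually_mul_log_pow_le)

variable {K : Type*} [Field K] {d₀ d₁ : ℕ}

/-! ### Polynomials on `G(K)`: vanishing everywhere, polynomials free of `Y` -/

/-- **A polynomial vanishing on `K^{d₀} × (Kˣ)^{d₁}` is zero** (`K` infinite: `P · ∏ⱼ Yⱼ` vanishes
on all of `K^{d₀ + d₁}`). [folklore] -/
theorem eq_zero_of_forall_evalAt_eq_zero [Infinite K] {P : MvPolynomial (Fin d₀ ⊕ Fin d₁) K}
    (h : ∀ g : LinGroupK K d₀ d₁, evalAt P g = 0) : P = 0 := by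
  have hprod : P * ∏ j : Fin d₁, X (Sum.inr j) = 0 := by
    apply MvPolynomial.funext
    intro x
    rw [map_mul, map_prod, map_zero]
    by_cases hx : ∀ j, x (Sum.inr j) ≠ 0
    · let g : LinGroupK K d₀ d₁ :=
        (Multiplicative.ofAdd fun i => x (Sum.inl i), fun j => Units.mk0 (x (Sum.inr j)) (hx j))
      have hg : coord g = x := by
        funext v
        rcases v with i | j <;> rfl
      have := h g
      rw [evalAt, hg] at this
      rw [this, zero_mul]
    · push Not at hx
      obtain ⟨j, hj⟩ := hx
      rw [Finset.prod_eq_zero (Finset.mem_univ j) (by rw [eval_X, hj]), mul_zero]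
  have hne : (∏ j : Fin d₁, X (Sum.inr j) : MvPolynomial (Fin d₀ ⊕ Fin d₁) K) ≠ 0 :=
    Finset.prod_ne_zero_iff.2 fun j _ => X_ne_zero _
  exact (mul_eq_zero.1 hprod).resolve_right hne

/-- If `P` vanishes at `g · h` for all `h` in the whole group then `P = 0`. [folklore] -/
theorem eq_zero_of_forall_evalAt_mul_top [Infinite K] {P : MvPolynomial (Fin d₀ ⊕ Fin d₁) K}
    (g : LinGroupK K d₀ d₁)
    (h : ∀ h ∈ (ConnAlgSubgroup.top K d₀ d₁).toSubgroup, evalAt P (g * h) = 0) : P = 0 :=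
  eq_zero_of_forall_evalAt_eq_zero fun g' => by
    have := h (g⁻¹ * g') (ConnAlgSubgroup.mem_toSubgroup_top _)
    rwa [mul_inv_cancel_left] at this

/-- **A polynomial free of `Y` only sees the additive coordinates.** [folklore] -/
theorem evalAt_eq_of_degY_eq_zero {P : MvPolynomial (Fin d₀ ⊕ Fin d₁) K} (hP : degY P = 0)
    {g g' : LinGroupK K d₀ d₁} (hgg' : g.1 = g'.1) : evalAt P g = evalAt P g' := by
  have hsupp : ∀ s ∈ P.support, ∀ j, s (Sum.inr j) = 0 := by
    intro s hs j
    have h1 : ∑ j, s (Sum.inr j) ≤ 0 := by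
      have := degY_le_iff.1 (le_of_eq hP) s hs
      simpa using this
    exact Finset.sum_eq_zero_iff.1 (Nat.le_zero.1 h1) j (Finset.mem_univ j)
  rw [evalAt, evalAt, MvPolynomial.eval_eq, MvPolynomial.eval_eq]
  refine Finset.sum_congr rfl fun s hs => ?_
  congr 1
  refine Finset.prod_congr rfl fun v hv => ?_
  rcases v with i | j
  · simp [coord, hgg']
  · have : s (Sum.inr j) = 0 := hsupp s hs j
    rw [Finsupp.mem_support_iff] at hv
    exact absurd this hv

/-- If `degY P < 1` then `degY P = 0`. [folklore] -/
theorem degY_eq_zero_of_lt_one {P : MvPolynomial (Fin d₀ ⊕ Fin d₁) K} {x : ℝ}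
    (hP : (degY P : ℝ) ≤ x) (hx : x < 1) : degY P = 0 := by
  have : (degY P : ℝ) < 1 := hP.trans_lt hx
  exact_mod_cast (Nat.lt_one_iff.1 (by exact_mod_cast this))

/-! ### The enlargement `E × T' ↦ E × 𝔾ₘ^{d₁}` and non-degeneracy -/

namespace ConnAlgSubgroup

/-- `H♯ = E × 𝔾ₘ^{d₁}`: same vector part, full torus. [folklore] -/
def sharp (H : ConnAlgSubgroup K d₀ d₁) : ConnAlgSubgroup K d₀ d₁ :=
  ⟨H.addPart, ⊥, (top K d₀ d₁).saturated⟩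

/-- `G' ≤ G'♯`. [folklore] -/
theorem toSubgroup_le_sharp (H : ConnAlgSubgroup K d₀ d₁) : H.toSubgroup ≤ H.sharp.toSubgroup := by
  intro g hg
  refine (H.sharp.mem_toSubgroup_iff g).2 ⟨((H.mem_toSubgroup_iff g).1 hg).1, fun χ hχ => ?_⟩
  simp only [sharp, AddSubgroup.mem_bot] at hχ
  simp [hχ]

/-- `Lie T'♯ = K^{d₁}`. [folklore] -/
@[simp] theorem torusTangent_sharp (H : ConnAlgSubgroup K d₀ d₁) : H.sharp.torusTangent = ⊤ := by
  rw [eq_top_iff]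
  intro v _ χ hχ
  simp only [sharp, AddSubgroup.mem_bot] at hχ
  simp [hχ]

/-- `Lie G'♯ = E × K^{d₁}`. [folklore] -/
theorem tangent_sharp (H : ConnAlgSubgroup K d₀ d₁) : H.sharp.tangent = H.addPart.prod ⊤ := by
  rw [tangent, torusTangent_sharp]
  rfl

/-- `Lie G' ≤ Lie G'♯`. [folklore] -/
theorem tangent_le_sharp (H : ConnAlgSubgroup K d₀ d₁) : H.tangent ≤ H.sharp.tangent := by
  rw [tangent_sharp, tangent]
  exact Submodule.prod_mono le_rfl le_top

/-- `dim E♯ = dim E`. [folklore] -/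
@[simp] theorem addDim_sharp (H : ConnAlgSubgroup K d₀ d₁) : H.sharp.addDim = H.addDim := rfl

/-- `E♯ = E`. [folklore] -/
@[simp] theorem addPart_sharp (H : ConnAlgSubgroup K d₀ d₁) : H.sharp.addPart = H.addPart := rfl

/-- `dim T'♯ = d₁`. [folklore] -/
@[simp] theorem torusDim_sharp (H : ConnAlgSubgroup K d₀ d₁) : H.sharp.torusDim = d₁ := by
  rw [torusDim, torusTangent_sharp, finrank_top, Module.finrank_fin_fun]

/-- A polynomial free of `Y` vanishing on a translate of `G'` vanishes on the same translate of
`G'♯`. [folklore] -/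
theorem vanish_sharp_of_degY_eq_zero (H : ConnAlgSubgroup K d₀ d₁) {P : MvPolynomial (Fin d₀ ⊕ Fin d₁) K}
    (hP : degY P = 0) {g : LinGroupK K d₀ d₁} (h : ∀ h ∈ H.toSubgroup, evalAt P (g * h) = 0) :
    ∀ h ∈ H.sharp.toSubgroup, evalAt P (g * h) = 0 := by
  intro h' hh'
  have hmem : ((h'.1, 1) : LinGroupK K d₀ d₁) ∈ H.toSubgroup :=
    (H.mem_toSubgroup_iff _).2 ⟨((H.sharp.mem_toSubgroup_iff h').1 hh').1, fun χ _ => by simp⟩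
  rw [← h _ hmem]
  exact evalAt_eq_of_degY_eq_zero hP rfl

/-- **`G' ≠ G`** for an obstruction: if `P ≠ 0` vanishes on a translate of `G'` then
`Lie G' ≠ Lie G`. [folklore] -/
theorem tangent_ne_top_of_vanish [CharZero K] (H : ConnAlgSubgroup K d₀ d₁)
    {P : MvPolynomial (Fin d₀ ⊕ Fin d₁) K} (hP : P ≠ 0) {g : LinGroupK K d₀ d₁}
    (h : ∀ h ∈ H.toSubgroup, evalAt P (g * h) = 0) : H.tangent ≠ ⊤ := by
  haveI : Infinite K := Infinite.of_injective ((↑) : ℕ → K) Nat.cast_injective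
  intro htop
  rw [tangent, Submodule.prod_eq_top_iff] at htop
  obtain ⟨hE, hF⟩ := htop
  have hchars : ∀ χ ∈ H.chars, χ = 0 := by
    intro χ hχ
    funext j
    have hv : (Pi.single j (1 : K) : Fin d₁ → K) ∈ H.torusTangent := by rw [hF]; trivial
    have := hv χ hχ
    rw [Finset.sum_eq_single j (fun b _ hb => by simp [Pi.single_eq_of_ne hb])
      (fun h => absurd (Finset.mem_univ j) h)] at this
    simpa using this
  apply hP
  refine eq_zero_of_forall_evalAt_mul_top g fun g' _ => h g' ?_
  refine (H.mem_toSubgroup_iff g').2 ⟨by rw [hE]; trivial, fun χ hχ => ?_⟩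
  simp [hchars χ hχ]

/-- `dim E ≤ d₀`. [folklore] -/
theorem addDim_le (H : ConnAlgSubgroup K d₀ d₁) : H.addDim ≤ d₀ := by
  have h := Submodule.finrank_le H.addPart
  rwa [Module.finrank_fin_fun] at h

/-- `dim T' ≤ d₁`. [folklore] -/
theorem torusDim_le (H : ConnAlgSubgroup K d₀ d₁) : H.torusDim ≤ d₁ := by
  have h := Submodule.finrank_le H.torusTangent
  rwa [Module.finrank_fin_fun] at h

/-- `dim Lie G' = dim E + dim T'`. [folklore] -/
theorem finrank_tangent (H : ConnAlgSubgroup K d₀ d₁) : finrank K H.tangent = H.addDim + H.torusDim := by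
  rw [ConnAlgSubgroup.tangent, finrank_prod_eq]
  rfl

end ConnAlgSubgroup

/-- `dim Lie G = d₀ + d₁`. [folklore] -/
theorem finrank_lie (K : Type*) [Field K] (d₀ d₁ : ℕ) :
    finrank K ((Fin d₀ → K) × (Fin d₁ → K)) = d₀ + d₁ := by
  rw [Module.finrank_prod, Module.finrank_fin_fun, Module.finrank_fin_fun]

/-- `dim(Lie G' + W) + dim(W ∩ Lie G') = dim Lie G' + dim W`, `dim(Lie G' + W) ≤ d₀ + d₁`,
`dim(W ∩ Lie G') ≤ dim W`. [folklore] -/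
theorem ConnAlgSubgroup.finrank_sup_facts (W : Submodule K ((Fin d₀ → K) × (Fin d₁ → K)))
    (H : ConnAlgSubgroup K d₀ d₁) :
    finrank K ↥(H.tangent ⊔ W) + finrank K ↥(W ⊓ H.tangent) = H.addDim + H.torusDim + finrank K W ∧
      finrank K ↥(H.tangent ⊔ W) ≤ d₀ + d₁ ∧ finrank K ↥(W ⊓ H.tangent) ≤ finrank K W := by
  refine ⟨?_, ?_, Submodule.finrank_mono inf_le_left⟩
  · rw [inf_comm, ← H.finrank_tangent]
    exact Submodule.finrank_sup_add_finrank_inf_eq _ _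
  · rw [← finrank_lie K d₀ d₁]
    exact Submodule.finrank_le _

/-! ### The points `γ(h)`, their boxes, classes modulo `G'` -/

section Points

variable {m : ℕ} (γ : Multiplicative (Fin m → ℤ) →* LinGroupK K d₀ d₁)

/-- **The points `Γ(N) = {γ(h) ; 0 ≤ hⱼ ≤ N}`** (for `γ(h) = exp_G(h₁y₁ + ⋯ + h_my_m)` this is
Waldschmidt's `exp_G Y(N)`). [cite: Waldschmidt1988, §6 (p. 389)] -/
def boxPts (N : ℕ) : Set (LinGroupK K d₀ d₁) :=
  (fun h : Fin m → ℕ => γ (Multiplicative.ofAdd fun j => (h j : ℤ))) '' {h | ∀ j, h j ≤ N}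

/-- `e ∈ Γ(N)` (`h = 0`). [folklore] -/
theorem one_mem_boxPts (N : ℕ) : (1 : LinGroupK K d₀ d₁) ∈ boxPts γ N := by
  refine ⟨0, fun _ => Nat.zero_le _, ?_⟩
  have : (fun j : Fin m => ((0 : Fin m → ℕ) j : ℤ)) = 0 := by funext j; simp
  simp only [this, ofAdd_zero, map_one]

/-- `Γ(N)` is finite. [folklore] -/
theorem boxPts_finite (N : ℕ) : (boxPts γ N).Finite := by
  refine Set.Finite.image _ ?_
  have : {h : Fin m → ℕ | ∀ j, h j ≤ N} ⊆ Set.pi Set.univ fun _ => Set.Iic N := by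
    intro h hh j _
    exact hh j
  exact Set.Finite.subset (Set.Finite.pi fun _ => Set.finite_Iic N) this

/-- **`Γ(N)(n) ⊆ Γ(nN)`.** [cite: Philippon1986, §2 (`Σ(n)`)] -/
theorem sumset_boxPts_subset (N n : ℕ) : sumset (boxPts γ N) n ⊆ boxPts γ (n * N) := by
  rintro g ⟨σ, hσ, rfl⟩
  choose h hh hσh using hσ
  refine ⟨fun j => ∑ i, h i j, fun j => ?_, ?_⟩
  · calc ∑ i, h i j ≤ ∑ _i : Fin n, N := Finset.sum_le_sum fun i _ => hh i j
      _ = n * N := by simp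
  · show γ (Multiplicative.ofAdd fun j => ((∑ i, h i j : ℕ) : ℤ)) = ∏ i, σ i
    have e1 : (fun j => ((∑ i, h i j : ℕ) : ℤ)) = ∑ i, (fun j => (h i j : ℤ)) := by
      funext j
      rw [Finset.sum_apply]
      push_cast
      rfl
    rw [e1, ofAdd_sum, map_prod]
    exact Finset.prod_congr rfl fun i _ => hσh i

/-- `γ(k)⁻¹ · γ(k') = γ(k' − k)`. [folklore] -/
theorem inv_mul_eq (k k' : Fin m → ℤ) :
    (γ (Multiplicative.ofAdd k))⁻¹ * γ (Multiplicative.ofAdd k') = γ (Multiplicative.ofAdd (k' - k)) := by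
  rw [← map_inv, ← map_mul]
  congr 1
  rw [← ofAdd_neg, ← ofAdd_add, neg_add_eq_sub]

/-- **Counting classes.** If every `k ∈ ℤ^m` with `γ(k) ∈ G'` lies (as a rational vector) in a
`ℚ`-subspace `Q ⊆ ℚ^m`, then `Γ(N)` has at least `(N+1)^{m − dim Q}` classes modulo `G'`.
[cite: NesterenkoPhilippon2001, Ch. 11 proof of Cor. 4.2 (p. 222)] -/
theorem pow_le_ncard_classes (H : ConnAlgSubgroup K d₀ d₁) (N : ℕ) (Q : Submodule ℚ (Fin m → ℚ))
    (hQ : ∀ k : Fin m → ℤ, γ (Multiplicative.ofAdd k) ∈ H.toSubgroup → (fun j => (k j : ℚ)) ∈ Q) :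
    (N + 1) ^ (m - finrank ℚ Q) ≤
      Set.ncard ((QuotientGroup.mk : LinGroupK K d₀ d₁ → LinGroupK K d₀ d₁ ⧸ H.toSubgroup) '' boxPts γ N) := by
  classical
  obtain ⟨κ, _, a, ha, hl, hsupp⟩ := exists_coord_complement_rat m Q
  let hu : (κ → Fin (N + 1)) → (Fin m → ℕ) := fun u j => ∑ k, if a k = j then (u k : ℕ) else 0
  have hu_apply : ∀ u k, hu u (a k) = u k := by
    intro u k
    simp only [hu]
    rw [Finset.sum_eq_single k (fun k' _ hk' => by simp [ha.ne hk']) (by simp)]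
    simp
  have hu_off : ∀ u j, (¬ ∃ k, a k = j) → hu u j = 0 := by
    intro u j hj
    simp only [hu]
    exact Finset.sum_eq_zero fun k _ => by
      rw [if_neg]
      exact fun h => hj ⟨k, h⟩
  have hu_le : ∀ u j, hu u j ≤ N := by
    intro u j
    by_cases hj : ∃ k, a k = j
    · obtain ⟨k, rfl⟩ := hj
      rw [hu_apply]
      exact Nat.lt_succ_iff.1 (u k).2
    · rw [hu_off u j hj]
      exact Nat.zero_le _
  let f : (κ → Fin (N + 1)) → LinGroupK K d₀ d₁ ⧸ H.toSubgroup := fun u =>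
    QuotientGroup.mk (γ (Multiplicative.ofAdd fun j => (hu u j : ℤ)))
  have hf_mem : ∀ u, f u ∈
      (QuotientGroup.mk : LinGroupK K d₀ d₁ → LinGroupK K d₀ d₁ ⧸ H.toSubgroup) '' boxPts γ N :=
    fun u => ⟨_, ⟨hu u, hu_le u, rfl⟩, rfl⟩
  have hf_inj : Function.Injective f := by
    intro u u' huu'
    have hmem : (γ (Multiplicative.ofAdd fun j => (hu u j : ℤ)))⁻¹ *
        γ (Multiplicative.ofAdd fun j => (hu u' j : ℤ)) ∈ H.toSubgroup := QuotientGroup.eq.1 huu'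
    rw [inv_mul_eq] at hmem
    have hq := hQ _ hmem
    have hzero := hsupp _ hq fun j hj => by
      simp only [Pi.sub_apply, hu_off u j hj, hu_off u' j hj, Nat.cast_zero, sub_zero, Int.cast_zero]
    funext k
    have hk := congrFun hzero (a k)
    simp only [Pi.sub_apply, hu_apply, Pi.zero_apply] at hk
    have hk' : ((u' k : ℕ) : ℚ) = ((u k : ℕ) : ℚ) := by
      push_cast at hk
      linarith
    exact Fin.ext (by exact_mod_cast hk'.symm)
  have hcard : m - finrank ℚ Q = Fintype.card κ := by omega
  calc (N + 1) ^ (m - finrank ℚ Q) = Nat.card (κ → Fin (N + 1)) := by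
        rw [Nat.card_eq_fintype_card, hcard, Fintype.card_fun, Fintype.card_fin]
    _ = (Set.range f).ncard := (Set.ncard_range_of_injective hf_inj).symm
    _ ≤ Set.ncard ((QuotientGroup.mk : LinGroupK K d₀ d₁ → LinGroupK K d₀ d₁ ⧸ H.toSubgroup) ''
          boxPts γ N) :=
        Set.ncard_le_ncard (Set.range_subset_iff.2 hf_mem) ((boxPts_finite γ N).image _)

end Points

/-! ### Bookkeeping of an obstruction against `W` and `γ` -/

section Bookkeeping

variable {m : ℕ} (W : Submodule K ((Fin d₀ → K) × (Fin d₁ → K))) (H : ConnAlgSubgroup K d₀ d₁)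

/-- **The winning case** (generic `λ ≤ m`): if `Lie G' ≠ Lie G` and the key inequality
`(Δ/(2dL))^τ (S/d)^λ ≤ c τ! (2Δ/L²)^{δ₀} (2Δ/S)^{δ₁}` holds at a value of `S` so large that every
losing comparison of exponents is already violated, then `δ > τ` and `(λ + δ₁)(d − n) ≤ (δ − τ) d₁`.
[cite: Waldschmidt1988, §7 (p. 390)] -/
theorem good_of_key {n : ℕ} (hn : n < d₀ + d₁) (hH : H.tangent ≠ ⊤) (c : ℕ) {lam : ℕ}
    (hlam_le : lam ≤ m) {S L Δ C : ℝ} (hS : 0 < S) (hL : 0 < L) (hΔ : 0 < Δ)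
    (hC : 1 ≤ C) (hΔeq : Δ ^ (d₀ + d₁ - n) = C * S ^ d₁ * L ^ (2 * d₀))
    (h : (Δ / (2 * (d₀ + d₁ : ℕ) * L)) ^ (finrank K W - finrank K ↥(W ⊓ H.tangent)) *
        (S / (d₀ + d₁ : ℕ)) ^ lam ≤
      ((c : ℝ) * ((finrank K W - finrank K ↥(W ⊓ H.tangent)).factorial : ℝ)) *
        (2 * Δ / L ^ 2) ^ (d₀ - H.addDim) * (2 * Δ / S) ^ (d₁ - H.torusDim))
    (hwin : ∀ lam' δ₀' δ₁' τ' : ℕ, lam' ≤ m → δ₀' ≤ d₀ → δ₁' ≤ d₁ → τ' ≤ finrank K W →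
      (d₁ * (δ₀' + δ₁') < d₁ * τ' + (lam' + δ₁') * (d₀ + d₁ - n) ∨
        (d₁ * τ' + (lam' + δ₁') * (d₀ + d₁ - n) = d₁ * (δ₀' + δ₁') ∧
          2 * d₀ * (δ₀' + δ₁') + τ' * (d₀ + d₁ - n) < 2 * d₀ * τ' + 2 * δ₀' * (d₀ + d₁ - n))) →
      (((c : ℝ) * (τ'.factorial : ℝ)) * (2 * (d₀ + d₁ : ℕ)) ^ τ' * (d₀ + d₁ : ℕ) ^ lam' *
            2 ^ (δ₀' + δ₁')) ^ (d₀ + d₁ - n) * C ^ (δ₀' + δ₁') *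
          S ^ (d₁ * (δ₀' + δ₁')) * L ^ (2 * d₀ * (δ₀' + δ₁') + τ' * (d₀ + d₁ - n)) <
        S ^ (d₁ * τ' + (lam' + δ₁') * (d₀ + d₁ - n)) * L ^ (2 * d₀ * τ' + 2 * δ₀' * (d₀ + d₁ - n))) :
    H.tangent ⊔ W ≠ ⊤ ∧
      (lam + (d₁ - H.torusDim)) * (d₀ + d₁ - n) ≤ (d₀ + d₁ - finrank K ↥(H.tangent ⊔ W)) * d₁ := by
  have he := H.addDim_le
  have hf := H.torusDim_le
  obtain ⟨hsum, hu_le, hi_le⟩ := H.finrank_sup_facts W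
  set t := finrank K W with ht
  set i := finrank K ↥(W ⊓ H.tangent) with hi
  set u := finrank K ↥(H.tangent ⊔ W) with hu
  set τ := t - i with hτ
  set δ₀ := d₀ - H.addDim with hδ₀
  set δ₁ := d₁ - H.torusDim with hδ₁
  set dn := d₀ + d₁ - n with hdn
  have hdn0 : 0 < dn := by omega
  have hτδ : τ ≤ δ₀ + δ₁ := by omega
  have hne : ¬ (δ₀ = 0 ∧ δ₁ = 0) := by
    rintro ⟨h0, h1⟩
    apply hH
    apply Submodule.eq_top_of_finrank_eq
    rw [finrank_lie, H.finrank_tangent]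
    omega
  by_cases hgood : τ < δ₀ + δ₁ ∧ (lam + δ₁) * dn ≤ (δ₀ + δ₁ - τ) * d₁
  · obtain ⟨hg1, hg2⟩ := hgood
    have hdu : d₀ + d₁ - u = δ₀ + δ₁ - τ := by omega
    refine ⟨fun htop => ?_, ?_⟩
    · have : u = d₀ + d₁ := by rw [hu, htop, finrank_top, finrank_lie]
      omega
    · rw [hdu]
      exact hg2
  · exfalso
    have hexp := exponents_of_bad (d₀ := d₀) hdn0 hτδ hne hgood
    have hlt := hwin lam δ₀ δ₁ τ hlam_le (Nat.sub_le _ _) (Nat.sub_le _ _) (Nat.sub_le _ _) hexp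
    have hd : 0 < d₀ + d₁ := by omega
    have hle := exponent_ineq_of_key (K := (c : ℝ) * (τ.factorial : ℝ)) (d := d₀ + d₁) hS hL hΔ hC
      (by positivity) hd hΔeq hτδ h
    exact lt_irrefl _ (hle.trans_lt hlt)

/-- Classes modulo a larger subgroup are fewer. [folklore] -/
theorem ncard_classes_mono {H H' : ConnAlgSubgroup K d₀ d₁} (hle : H.toSubgroup ≤ H'.toSubgroup)
    {Sg : Set (LinGroupK K d₀ d₁)} (hSg : Sg.Finite) :
    Set.ncard ((QuotientGroup.mk : LinGroupK K d₀ d₁ → LinGroupK K d₀ d₁ ⧸ H'.toSubgroup) '' Sg) ≤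
      Set.ncard ((QuotientGroup.mk : LinGroupK K d₀ d₁ → LinGroupK K d₀ d₁ ⧸ H.toSubgroup) '' Sg) := by
  have hcomap : H.toSubgroup ≤ H'.toSubgroup.comap (MonoidHom.id (LinGroupK K d₀ d₁)) := by
    simpa using hle
  have e : (QuotientGroup.mk : LinGroupK K d₀ d₁ → LinGroupK K d₀ d₁ ⧸ H'.toSubgroup) '' Sg =
      (QuotientGroup.map H.toSubgroup H'.toSubgroup (MonoidHom.id _) hcomap) ''
        ((QuotientGroup.mk : LinGroupK K d₀ d₁ → LinGroupK K d₀ d₁ ⧸ H.toSubgroup) '' Sg) := by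
    rw [Set.image_image]
    rfl
  rw [e]
  exact Set.ncard_image_le (hSg.image _)

end Bookkeeping

/-! ### The assembly -/

section Assembly

variable [CharZero K] {m : ℕ} (γ : Multiplicative (Fin m → ℤ) →* LinGroupK K d₀ d₁)
  (Q : ConnAlgSubgroup K d₀ d₁ → Submodule ℚ (Fin m → ℚ))
  (W : Submodule K ((Fin d₀ → K) × (Fin d₁ → K)))

set_option maxHeartbeats 800000 in
/-- **Waldschmidt 1988, Theorem 4.1 for `𝔾ₐ^{d₀} × 𝔾ₘ^{d₁}` over a field `K` of characteristic
`0`, proof of §7, from a zero estimate and an auxiliary function** (period-free, abstract form):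
given a homomorphism `γ : ℤ^m → G(K)`, an assignment `Q(G') ⊆ ℚ^m` of `ℚ`-subspaces containing
every `h` with `γ(h) ∈ G'` (`hQ`), Philippon's zero estimate over `K` (`hZE`) and the auxiliary
functions of [Waldschmidt1988, Prop. 6.1] vanishing along `W` at the points `γ(h)`, `0 ≤ hⱼ ≤ S`
(`hAF`), there is an obstruction `G' = E × T'` with `Lie G' + W ≠ Lie G` and
`(λ + δ₁)(d − n) ≤ (δ − τ) d₁`, `λ = m − dim_ℚ Q(G')`, `δ₁ = d₁ − dim T'`,
`δ − τ = d − dim(Lie G' + W)`. The proof is [Waldschmidt1988, §7, p. 390] exactly as in the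
tree's complex `LinGroup.weakObstruction_of_zeroEstimate_of_auxiliary`.
[cite: Waldschmidt1988, §4 Theorem 4.1 (pp. 382–383); §7 (pp. 389–390)] [cite: Philippon1986, Thm 2.1] -/
theorem weakObstruction_of_zeroEstimate_of_auxiliary
    (hQ : ∀ (H : ConnAlgSubgroup K d₀ d₁) (k : Fin m → ℤ),
      γ (Multiplicative.ofAdd k) ∈ H.toSubgroup → (fun j => (k j : ℚ)) ∈ Q H)
    (hZE : ZeroEstimate K d₀ d₁) {n : ℕ} (hn : n < d₀ + d₁)
    (hAF : ∃ (C : ℝ) (S₀ : ℕ), 1 ≤ C ∧ ∀ S : ℕ, S₀ ≤ S →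
      ∃ (P : MvPolynomial (Fin d₀ ⊕ Fin d₁) K) (T : ℕ), P ≠ 0 ∧
        auxDelta C d₀ d₁ n S / Real.log S ≤ T ∧
        (degX P : ℝ) ≤ auxDelta C d₀ d₁ n S / Real.log S ^ 2 ∧
        (degY P : ℝ) ≤ auxDelta C d₀ d₁ n S / S ∧
        ∀ h : Fin m → ℕ, (∀ j, h j ≤ S) →
          VanishesAlg P W (γ (Multiplicative.ofAdd fun j => (h j : ℤ))) T) :
    ∃ H : ConnAlgSubgroup K d₀ d₁, H.tangent ⊔ W ≠ ⊤ ∧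
      (m - finrank ℚ (Q H) + (d₁ - H.torusDim)) * (d₀ + d₁ - n) ≤
        (d₀ + d₁ - finrank K ↥(H.tangent ⊔ W)) * d₁ := by
  classical
  obtain ⟨c, hZE⟩ := hZE
  obtain ⟨C, S₀, hC, hAFS⟩ := hAF
  set d : ℕ := d₀ + d₁ with hd
  set dn : ℕ := d₀ + d₁ - n with hdn
  have hd0 : 0 < d := by omega
  have hdn0 : 0 < dn := by omega
  set t : ℕ := finrank K W with ht
  /- Step 0: `S` large. -/
  have hev : ∀ᶠ S : ℕ in Filter.atTop, S₀ ≤ S ∧ 3 ≤ S ∧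
      Real.log S ^ (2 * dn) ≤ (S : ℝ) ∧ ((4 * d : ℕ) : ℝ) ^ dn * Real.log S ^ dn ≤ (S : ℝ) ∧
      ((4 * d : ℕ) : ℝ) ≤ Real.log S ∧ 2 * C * Real.log S ^ (2 * d₀) ≤ (S : ℝ) ∧
      ∀ θ : Fin (m + 1) × Fin (d₀ + 1) × Fin (d₁ + 1) × Fin (t + 1),
        (d₁ * ((θ.2.1 : ℕ) + (θ.2.2.1 : ℕ)) < d₁ * (θ.2.2.2 : ℕ) + ((θ.1 : ℕ) + (θ.2.2.1 : ℕ)) * dn ∨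
          (d₁ * (θ.2.2.2 : ℕ) + ((θ.1 : ℕ) + (θ.2.2.1 : ℕ)) * dn = d₁ * ((θ.2.1 : ℕ) + (θ.2.2.1 : ℕ)) ∧
            2 * d₀ * ((θ.2.1 : ℕ) + (θ.2.2.1 : ℕ)) + (θ.2.2.2 : ℕ) * dn <
              2 * d₀ * (θ.2.2.2 : ℕ) + 2 * (θ.2.1 : ℕ) * dn)) →
        (((c : ℝ) * ((θ.2.2.2 : ℕ).factorial : ℝ)) * (2 * (d₀ + d₁ : ℕ)) ^ (θ.2.2.2 : ℕ) *
              (d₀ + d₁ : ℕ) ^ (θ.1 : ℕ) * 2 ^ ((θ.2.1 : ℕ) + (θ.2.2.1 : ℕ))) ^ dn *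
            C ^ ((θ.2.1 : ℕ) + (θ.2.2.1 : ℕ)) *
            (S : ℝ) ^ (d₁ * ((θ.2.1 : ℕ) + (θ.2.2.1 : ℕ))) *
            Real.log S ^ (2 * d₀ * ((θ.2.1 : ℕ) + (θ.2.2.1 : ℕ)) + (θ.2.2.2 : ℕ) * dn) <
          (S : ℝ) ^ (d₁ * (θ.2.2.2 : ℕ) + ((θ.1 : ℕ) + (θ.2.2.1 : ℕ)) * dn) *
            Real.log S ^ (2 * d₀ * (θ.2.2.2 : ℕ) + 2 * (θ.2.1 : ℕ) * dn) := by
    refine (Filter.eventually_ge_atTop S₀).and ((Filter.eventually_ge_atTop 3).and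
      ((eventually_mul_log_pow_le 1 (2 * dn)).mono (fun S h => by simpa using h) |>.and
      ((eventually_mul_log_pow_le (((4 * d : ℕ) : ℝ) ^ dn) dn).and
      ((tendsto_natCast_atTop_atTop.eventually
        (Real.tendsto_log_atTop.eventually (Filter.eventually_ge_atTop _))).and
      ((eventually_mul_log_pow_le (2 * C) (2 * d₀)).and ?_)))))
    refine Filter.eventually_all.2 fun θ => ?_
    by_cases hθ : (d₁ * ((θ.2.1 : ℕ) + (θ.2.2.1 : ℕ)) < d₁ * (θ.2.2.2 : ℕ) + ((θ.1 : ℕ) + (θ.2.2.1 : ℕ)) * dn ∨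
          (d₁ * (θ.2.2.2 : ℕ) + ((θ.1 : ℕ) + (θ.2.2.1 : ℕ)) * dn = d₁ * ((θ.2.1 : ℕ) + (θ.2.2.1 : ℕ)) ∧
            2 * d₀ * ((θ.2.1 : ℕ) + (θ.2.2.1 : ℕ)) + (θ.2.2.2 : ℕ) * dn <
              2 * d₀ * (θ.2.2.2 : ℕ) + 2 * (θ.2.1 : ℕ) * dn))
    · exact (tendsto_natCast_atTop_atTop.eventually (eventually_lt_of_exponents _ hθ)).mono
        fun S h _ => h
    · exact Filter.Eventually.of_forall fun S h => absurd h hθ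
  obtain ⟨S, hS₀, hS3, hlog2dn, hlog4d, hlogd, hlogC, hwinS⟩ := hev.exists
  obtain ⟨P, T, hP0, hT, hdegX, hdegY, hvan⟩ := hAFS S hS₀
  /- Step 1: the real parameters. -/
  have hS1 : (1 : ℝ) ≤ S := by exact_mod_cast (show 1 ≤ S by omega)
  have hSpos : (0 : ℝ) < S := by linarith
  set L : ℝ := Real.log S with hL
  have hL1 : 1 ≤ L := by
    rw [hL, Real.le_log_iff_exp_le hSpos]
    have : (3 : ℝ) ≤ S := by exact_mod_cast hS3
    linarith [Real.exp_one_lt_three]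
  have hLpos : 0 < L := by linarith
  have hCpos : 0 < C := by linarith
  set B : ℝ := C * (S : ℝ) ^ d₁ * L ^ (2 * d₀) with hB
  have hBpos : 0 < B := by positivity
  set Δ : ℝ := auxDelta C d₀ d₁ n S with hΔdef
  have hΔB : Δ ^ dn = B := by
    rw [hΔdef, LinGroup.auxDelta]
    exact Real.rpow_inv_natCast_pow hBpos.le hdn0.ne'
  have hΔpos : 0 < Δ := by
    rw [hΔdef, LinGroup.auxDelta]
    exact Real.rpow_pos_of_pos hBpos _
  have root_le : ∀ {X : ℝ}, X ^ dn ≤ B → X ≤ Δ := fun h =>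
    le_of_pow_le_pow_left₀ hdn0.ne' hΔpos.le (by rwa [hΔB])
  have hS_le_B : 1 ≤ d₁ → (S : ℝ) ≤ B := fun hd₁ =>
    calc (S : ℝ) = (S : ℝ) ^ 1 := (pow_one _).symm
      _ ≤ (S : ℝ) ^ d₁ := pow_le_pow_right₀ hS1 hd₁
      _ ≤ C * (S : ℝ) ^ d₁ := le_mul_of_one_le_left (by positivity) hC
      _ ≤ C * (S : ℝ) ^ d₁ * L ^ (2 * d₀) := le_mul_of_one_le_right (by positivity) (one_le_pow₀ hL1)
  have hLpow_le_B : L ^ (2 * d₀) ≤ B := by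
    calc L ^ (2 * d₀) = 1 * 1 * L ^ (2 * d₀) := by ring
      _ ≤ C * (S : ℝ) ^ d₁ * L ^ (2 * d₀) :=
          mul_le_mul_of_nonneg_right (mul_le_mul hC (one_le_pow₀ hS1) zero_le_one hCpos.le)
            (by positivity)
  have hL2 : L ^ 2 ≤ Δ := by
    apply root_le
    rw [← pow_mul]
    by_cases hd₁ : 1 ≤ d₁
    · exact hlog2dn.trans (hS_le_B hd₁)
    · calc L ^ (2 * dn) ≤ L ^ (2 * d₀) := pow_le_pow_right₀ hL1 (by omega)
        _ ≤ B := hLpow_le_B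
  have h4dL : 4 * (d : ℝ) * L ≤ Δ := by
    apply root_le
    by_cases hd₁ : 1 ≤ d₁
    · calc (4 * (d : ℝ) * L) ^ dn = ((4 * d : ℕ) : ℝ) ^ dn * L ^ dn := by push_cast; ring
        _ ≤ S := hlog4d
        _ ≤ B := hS_le_B hd₁
    · have h4d : 4 * (d : ℝ) ≤ L := by exact_mod_cast hlogd
      calc (4 * (d : ℝ) * L) ^ dn ≤ (L * L) ^ dn :=
            pow_le_pow_left₀ (by positivity) (mul_le_mul_of_nonneg_right h4d hLpos.le) dn
        _ = L ^ (2 * dn) := by rw [← sq, ← pow_mul]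
        _ ≤ L ^ (2 * d₀) := pow_le_pow_right₀ hL1 (by omega)
        _ ≤ B := hLpow_le_B
  have hdpos : (0 : ℝ) < d := by exact_mod_cast hd0
  have hd1 : (1 : ℝ) ≤ d := by exact_mod_cast hd0
  /- Step 2: the points `Σ = Γ([S/d])`, the degrees `D₀, D₁`. -/
  set M : ℕ := S / d with hM
  set Sg : Set (LinGroupK K d₀ d₁) := boxPts γ M with hSg
  have hSg1 : (1 : LinGroupK K d₀ d₁) ∈ Sg := one_mem_boxPts γ M
  have hSgfin : Sg.Finite := boxPts_finite γ M
  have hdM : d * M ≤ S := Nat.mul_div_le S d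
  have hvan' : ∀ g ∈ sumset Sg d, VanishesAlg P W g T := by
    intro g hg
    obtain ⟨h, hh, rfl⟩ := sumset_boxPts_subset γ M d hg
    exact hvan h fun j => (hh j).trans hdM
  set D₀ : ℕ := max 1 (degX P) with hD₀
  set D₁ : ℕ := max 1 (degY P) with hD₁
  have hD₀1 : 1 ≤ D₀ := le_max_left _ _
  have hD₁1 : 1 ≤ D₁ := le_max_left _ _
  have hdegX' : degX P ≤ D₀ := le_max_right _ _
  have hdegY' : degY P ≤ D₁ := le_max_right _ _
  have hD₀r : (D₀ : ℝ) ≤ 2 * Δ / L ^ 2 := by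
    have h1 : (1 : ℝ) ≤ Δ / L ^ 2 := by rwa [le_div_iff₀ (by positivity), one_mul]
    have h2 : (D₀ : ℝ) ≤ Δ / L ^ 2 := by
      rw [hD₀, Nat.cast_max, Nat.cast_one]
      exact max_le h1 hdegX
    have h3 : 0 ≤ Δ / L ^ 2 := by positivity
    calc (D₀ : ℝ) ≤ Δ / L ^ 2 := h2
      _ ≤ 2 * (Δ / L ^ 2) := by linarith
      _ = 2 * Δ / L ^ 2 := by ring
  have hMr : (S : ℝ) / d ≤ (M : ℝ) + 1 := by
    rw [div_le_iff₀ hdpos]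
    have h1 : S < S / d * d + d := Nat.lt_div_mul_add hd0
    have h2 : ((S : ℕ) : ℝ) ≤ ((S / d * d + d : ℕ) : ℝ) := by exact_mod_cast h1.le
    push_cast at h2
    rw [hM]
    linarith
  /- Step 3: the zero estimate. -/
  have hT4d : 4 * (d : ℝ) ≤ T := by
    have : 4 * (d : ℝ) * L / L ≤ Δ / L := div_le_div_of_nonneg_right h4dL hLpos.le
    rw [mul_div_assoc, div_self hLpos.ne', mul_one] at this
    exact this.trans hT
  have hT1 : 1 ≤ T := by
    have : (1 : ℝ) ≤ T := by linarith
    exact_mod_cast this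
  obtain ⟨H₀, hvan₀, TZ, hXT, hZ₀⟩ : ∃ H₀ : ConnAlgSubgroup K d₀ d₁,
      (∃ g : LinGroupK K d₀ d₁, ∀ h ∈ H₀.toSubgroup, evalAt P (g * h) = 0) ∧ ∃ TZ : ℕ,
      (t = 0 ∨ Δ / (2 * d * L) ≤ TZ) ∧
      Nat.choose (TZ + (t - finrank K ↥(W ⊓ H₀.tangent))) (t - finrank K ↥(W ⊓ H₀.tangent)) *
        Set.ncard ((QuotientGroup.mk : LinGroupK K d₀ d₁ → LinGroupK K d₀ d₁ ⧸ H₀.toSubgroup) '' Sg) *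
        D₀ ^ H₀.addDim * D₁ ^ H₀.torusDim ≤ c * D₀ ^ d₀ * D₁ ^ d₁ := by
    by_cases ht0 : t = 0
    · have hvan1 : ∀ g ∈ sumset Sg d, VanishesAlg P ⊤ g (d * 0 + 1) := by
        intro g hg
        rw [mul_zero, zero_add, vanishesAlg_one_iff]
        exact (vanishesAlg_one_iff P W g).1 ((hvan' g hg).mono hT1)
      have htop : 0 < finrank K (⊤ : Submodule K ((Fin d₀ → K) × (Fin d₁ → K))) := by
        rw [finrank_top, finrank_lie]
        exact hd0
      obtain ⟨H₀, hg, hineq⟩ :=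
        hZE D₀ D₁ 0 ⊤ Sg P hD₀1 hD₁1 htop hSgfin hSg1 hP0 hdegX' hdegY' hvan1
      refine ⟨H₀, hg, 0, Or.inl ht0, ?_⟩
      rw [ht0, Nat.zero_sub, Nat.choose_zero_right, one_mul]
      rw [zero_add, Nat.choose_self, one_mul] at hineq
      exact hineq
    · have htpos : 0 < finrank K W := Nat.pos_of_ne_zero ht0
      set TZ : ℕ := (T - 1) / d with hTZ
      have hTZ1 : d * TZ + 1 ≤ T := by
        have hmul : d * TZ ≤ T - 1 := Nat.mul_div_le (T - 1) d
        omega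
      have hvan1 : ∀ g ∈ sumset Sg d, VanishesAlg P W g (d * TZ + 1) :=
        fun g hg => (hvan' g hg).mono hTZ1
      obtain ⟨H₀, hg, hineq⟩ :=
        hZE D₀ D₁ TZ W Sg P hD₀1 hD₁1 htpos hSgfin hSg1 hP0 hdegX' hdegY' hvan1
      refine ⟨H₀, hg, TZ, Or.inr ?_, hineq⟩
      have h1 : T - 1 < (T - 1) / d * d + d := Nat.lt_div_mul_add hd0
      have h2 : ((T - 1 : ℕ) : ℝ) ≤ (((T - 1) / d * d + d : ℕ) : ℝ) := by exact_mod_cast h1.le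
      rw [Nat.cast_sub hT1] at h2
      push_cast at h2
      rw [← hTZ] at h2
      have h3 : Δ / L ≤ (TZ : ℝ) * d + d + 1 := by linarith
      have h2L : (0 : ℝ) < 2 * L := by positivity
      have h4 : Δ / (2 * L) ≤ (TZ : ℝ) * d := by
        have h5 : (d : ℝ) + 1 ≤ Δ / (2 * L) := by
          rw [le_div_iff₀ h2L]
          have : 2 * L ≤ 2 * (d : ℝ) * L := by nlinarith
          nlinarith
        have h6 : Δ / L = Δ / (2 * L) + Δ / (2 * L) := by
          field_simp
          ring
        linarith
      have h2dL : (0 : ℝ) < 2 * d * L := by positivity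
      rw [div_le_iff₀ h2dL]
      rw [div_le_iff₀ h2L] at h4
      nlinarith
  /- Step 4: the final obstruction (enlarged to `E × 𝔾ₘ^{d₁}` when `d₁ < d - n`). -/
  obtain ⟨H, hvanH, hZH, hD₁H⟩ : ∃ H : ConnAlgSubgroup K d₀ d₁,
      (∃ g : LinGroupK K d₀ d₁, ∀ h ∈ H.toSubgroup, evalAt P (g * h) = 0) ∧
      Nat.choose (TZ + (t - finrank K ↥(W ⊓ H.tangent))) (t - finrank K ↥(W ⊓ H.tangent)) *
        Set.ncard ((QuotientGroup.mk : LinGroupK K d₀ d₁ → LinGroupK K d₀ d₁ ⧸ H.toSubgroup) '' Sg) *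
        D₀ ^ H.addDim * D₁ ^ H.torusDim ≤ c * D₀ ^ d₀ * D₁ ^ d₁ ∧
      ((D₁ : ℝ) ≤ 2 * Δ / S ∨ H.torusDim = d₁) := by
    by_cases hreg : d₁ < dn
    · have hΔS : Δ < S := by
        refine lt_of_pow_lt_pow_left₀ dn hSpos.le ?_
        rw [hΔB, hB]
        have h1 : C * L ^ (2 * d₀) < S := by nlinarith [pow_nonneg hLpos.le (2 * d₀)]
        calc C * (S : ℝ) ^ d₁ * L ^ (2 * d₀) = (C * L ^ (2 * d₀)) * (S : ℝ) ^ d₁ := by ring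
          _ < S * (S : ℝ) ^ d₁ := mul_lt_mul_of_pos_right h1 (by positivity)
          _ = (S : ℝ) ^ (d₁ + 1) := by ring
          _ ≤ (S : ℝ) ^ dn := pow_le_pow_right₀ hS1 hreg
      have hdegY0 : degY P = 0 :=
        degY_eq_zero_of_lt_one hdegY ((div_lt_one hSpos).2 hΔS)
      have hD₁eq : D₁ = 1 := by rw [hD₁, hdegY0]; rfl
      obtain ⟨g, hg⟩ := hvan₀
      refine ⟨H₀.sharp, ⟨g, H₀.vanish_sharp_of_degY_eq_zero hdegY0 hg⟩, ?_, Or.inr H₀.torusDim_sharp⟩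
      have hτle : t - finrank K ↥(W ⊓ H₀.sharp.tangent) ≤ t - finrank K ↥(W ⊓ H₀.tangent) :=
        Nat.sub_le_sub_left (Submodule.finrank_mono (inf_le_inf_left W H₀.tangent_le_sharp)) t
      rw [hD₁eq, one_pow, one_pow, mul_one, mul_one] at hZ₀ ⊢
      calc Nat.choose (TZ + (t - finrank K ↥(W ⊓ H₀.sharp.tangent)))
              (t - finrank K ↥(W ⊓ H₀.sharp.tangent)) *
            Set.ncard ((QuotientGroup.mk : LinGroupK K d₀ d₁ → LinGroupK K d₀ d₁ ⧸ H₀.sharp.toSubgroup) ''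
              Sg) * D₀ ^ H₀.sharp.addDim
          ≤ Nat.choose (TZ + (t - finrank K ↥(W ⊓ H₀.tangent))) (t - finrank K ↥(W ⊓ H₀.tangent)) *
            Set.ncard ((QuotientGroup.mk : LinGroupK K d₀ d₁ → LinGroupK K d₀ d₁ ⧸ H₀.toSubgroup) '' Sg) *
              D₀ ^ H₀.addDim := by
            rw [ConnAlgSubgroup.addDim_sharp]
            exact Nat.mul_le_mul_right _ (Nat.mul_le_mul (choose_diag_mono TZ hτle)
              (ncard_classes_mono H₀.toSubgroup_le_sharp hSgfin))
        _ ≤ c * D₀ ^ d₀ := hZ₀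
    · have hSΔ : (S : ℝ) ≤ Δ := by
        apply root_le
        calc (S : ℝ) ^ dn ≤ (S : ℝ) ^ d₁ := pow_le_pow_right₀ hS1 (by omega)
          _ ≤ C * (S : ℝ) ^ d₁ := le_mul_of_one_le_left (by positivity) hC
          _ ≤ B := le_mul_of_one_le_right (by positivity) (one_le_pow₀ hL1)
      refine ⟨H₀, hvan₀, hZ₀, Or.inl ?_⟩
      have h1 : (1 : ℝ) ≤ Δ / S := by rwa [le_div_iff₀ hSpos, one_mul]
      have h2 : (D₁ : ℝ) ≤ Δ / S := by
        rw [hD₁, Nat.cast_max, Nat.cast_one]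
        exact max_le h1 hdegY
      have h3 : 0 ≤ Δ / S := by positivity
      calc (D₁ : ℝ) ≤ Δ / S := h2
        _ ≤ 2 * (Δ / S) := by linarith
        _ = 2 * Δ / S := by ring
  /- Step 5: the key inequality for `H`, and the comparison of exponents. -/
  obtain ⟨g, hg⟩ := hvanH
  have hHne : H.tangent ≠ ⊤ := H.tangent_ne_top_of_vanish hP0 hg
  have he : H.addDim ≤ d₀ := H.addDim_le
  have hf : H.torusDim ≤ d₁ := H.torusDim_le
  refine ⟨H, good_of_key W H hn hHne c (lam := m - finrank ℚ (Q H)) (Nat.sub_le _ _) hSpos hLpos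
    hΔpos hC hΔB ?_ ?_⟩
  · set τ := t - finrank K ↥(W ⊓ H.tangent) with hτ
    have hτt : τ ≤ t := Nat.sub_le _ _
    refine key_real (B := Nat.choose (TZ + τ) τ)
      (N := Set.ncard ((QuotientGroup.mk : LinGroupK K d₀ d₁ → LinGroupK K d₀ d₁ ⧸ H.toSubgroup) '' Sg))
      (D₀ := D₀) (D₁ := D₁) (e := H.addDim) (f := H.torusDim) (by positivity) hD₀1 hD₁1 ?_ ?_ ?_
      hD₀r ?_
    · rw [Nat.add_sub_cancel' he, Nat.add_sub_cancel' hf]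
      exact hZH
    · rcases hXT with ht0 | hXTZ
      · have hτ0 : τ = 0 := by omega
        rw [hτ0, pow_zero, Nat.factorial_zero, add_zero, Nat.choose_zero_right]
        norm_num
      · calc (Δ / (2 * d * L)) ^ τ ≤ (TZ : ℝ) ^ τ := pow_le_pow_left₀ (by positivity) hXTZ τ
          _ ≤ (τ.factorial : ℝ) * ((TZ + τ).choose τ : ℝ) := pow_le_factorial_mul_choose TZ τ
    · have h1 := pow_le_ncard_classes γ H M (Q H) (hQ H)
      have h2 : ((((M + 1) ^ (m - finrank ℚ (Q H)) : ℕ) : ℝ)) ≤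
          (Set.ncard ((QuotientGroup.mk : LinGroupK K d₀ d₁ →
            LinGroupK K d₀ d₁ ⧸ H.toSubgroup) '' Sg) : ℝ) := by exact_mod_cast h1
      push_cast at h2
      exact (pow_le_pow_left₀ (by positivity) hMr _).trans h2
    · rcases hD₁H with hD₁r | hfd
      · exact pow_le_pow_left₀ (Nat.cast_nonneg _) hD₁r _
      · rw [hfd, Nat.sub_self, pow_zero, pow_zero]
  · intro lam' δ₀' δ₁' τ' h1 h2 h3 h4 hexp
    exact hwinS (⟨lam', by omega⟩, ⟨δ₀', by omega⟩, ⟨δ₁', by omega⟩, ⟨τ', by omega⟩) hexp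

end Assembly

end Literature.NumberTheory.Transcendental.LinGroupK
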